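import Summits.QuantumAdvantage.QuantumAdvantage.Theorems.CubicForrelationNearExactIsExactTwelveTypeO932Shape
import Summits.QuantumAdvantage.QuantumAdvantage.Theorems.CubicForrelationNearExactIsExactTwelveTypeO934Wild

/-!
# Crux `CubicForrelation.NearExactIsExact` (stmt-QuantumAdvantage-14043) — n = 12 at `Φ = 932/1024`, type O with base set `896`: the PARTNER is at
  level EXACTLY 5 (neither type O nor level `≥ 6`)

Certificate seat `b2b-cforr-cert` (gen 18).  HONEST FRAMING: a kernel-checked structure lemma (standard axioms) for the one open rung above the record
at `n = 12` (`932/1024 = 233/256`); nothing is closed here, NO new value of `θ₁₂`.  NOT summit progress.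

`to18_typeO_E896_ge932_partner`: cubic `f, g` with `g` type O (`W_g = 16u`, `u` odd), base set `#E = 896` and `Φ(f,g) ≥ 932/1024`; `W_f = 16u_f`.
Budget: `Σ τ² ≤ 11776 = 4096 + 8·896 + 512`, so the wild function `v` (`τ = τ₀ + 8v`) has `Σ v² ≤ 32` (`X ≥ 16v²` pointwise), and `v ≢ 0`
(else `Φ = 936/1024`, `to18_typeO_ge936_false`).  The partner identity (`to18_typeO_partner_identity`) with `Ê ∈ 128ℤ` (`to18_char_sum_E896`)
gives `v̂(y) = 8·(4(−1)^g − 64s_b[y=c₁] + 8s_b m(y) − u_f(y))`.  (a) If `f` were type O (`u_f` odd) then `|v̂| ≥ 8` everywhere and Parseval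
`Σ v̂² = 4096 Σv²` would force `Σ v² ≥ 64`.  (b) If `f` were at level `≥ 6` (`4 ∣ u_f`) then `32 ∣ v̂`, `|v̂| ≤ Σ|v| ≤ 32`, so `v̂ ∈ {0, ±32}` and the
level-6 parity set `Z_f = {u_f/4 even} = {v̂ ≠ 0}` would have `4·Σv² ≤ 128` points — but it is the (nonempty, since `v ≢ 0`) support of a cubic
(`stub_walshTower stub_axParity`), hence has `≥ 512` points.  So the partner is at level exactly 5: the `896`-configuration at `932/1024` is a
MIXED (type O, level 5) pair and belongs to the level-5 boundary analysis (HOME/b2b-cforr-cert-g18/PLAN-N12-932.md).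

References: Kasami–Tokura (1970); MacWilliams–Sloane (1977) Ch. 15; Carlet (2021) §5.2.  Axioms: the standard three.
-/

set_option linter.dupNamespace false -- D-0017: single-problem summit ⇒ `QuantumAdvantage.QuantumAdvantage` by design

noncomputable section

namespace Summit.QuantumAdvantage.QuantumAdvantage.Theorems.CubicForrelation.NearExactIsExact

open Finset
open Literature.Computability.QuantumComplexity
open Literature.Computability.QuantumComplexity.BuzetChailloux (bxor zeroVec bxor_bxor_cancel_left bxor_zeroVec zeroVec_bxor bxor_comm
  bxor_self twist_zeroVec_right twist_bxor_right)
open Literature.Computability.QuantumComplexity.DerivativeWalsh (W sum_W_sq)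
open Literature.Computability.QuantumComplexity.Simon (twist_eq_one_or)
open Summit.QuantumAdvantage.QuantumAdvantage.Theorems.NearExactIsExact.Negative (TypeOTwelve.typeO_of_exists_odd)

/-- **Type O with `#E = 896` at `Φ ≥ 932/1024`: the partner is at level exactly 5.**  See the module docstring.  NOT summit progress. [this work] -/
theorem to18_typeO_E896_ge932_partner (f g : (Fin (6 + 6) → Bool) → Bool) (hf : IsDegLeFun 3 f) (hg : IsDegLeFun 3 g)
    (u : (Fin (6 + 6) → Bool) → ℤ) (hu : ∀ x, W (fun y => signOf (g y)) x = (2 : ℝ) ^ 4 * (u x : ℝ))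
    (hodd : ∃ x, Odd (u x)) (hE : #(univ.filter fun x : Fin (6 + 6) → Bool => (Odd (u x / 2) ↔ Odd (u x / 2 / 2))) = 896)
    (hΦ : (932 / 1024 : ℝ) ≤ forrelation f g)
    (uf : (Fin (6 + 6) → Bool) → ℤ) (huf : ∀ y, W (fun x => signOf (f x)) y = (2 : ℝ) ^ 4 * (uf y : ℝ)) :
    (∀ y, ¬ Odd (uf y)) ∧ ¬ (∀ y, ¬ Odd (uf y / 2)) := by
  classical
  have hall : ∀ x, Odd (u x) := TypeOTwelve.typeO_of_exists_odd g u hg hu hodd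
  have hu' : ∀ x, W (fun y => signOf (g y)) x = (2 : ℝ) ^ (2 * 2) * (u x : ℝ) := fun x => (hu x).trans (by norm_num)
  have hd1 : IsDegLeFun 1 (fun x => decide (Odd (u x / 2))) := z2_digitOne 2 g u hg hu' hall
  have hd2 : IsDegLeFun 3 (fun x => decide (Odd (u x / 2 / 2))) := z2_digitTwo 2 g u hg hu' hall
  obtain ⟨c₁, b₁, hcb⟩ := stub_affineForm (6 + 6) _ hd1
  set E := univ.filter (fun x : Fin (6 + 6) → Bool => (Odd (u x / 2) ↔ Odd (u x / 2 / 2))) with hEdef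
  have hdegE : IsDegLeFun (2 + 1) (fun x => (decide (Odd (u x / 2)) ^^ decide (Odd (u x / 2 / 2))) ^^ true) :=
    tb_isDegLeFun_xor_const (bb_isDegLeFun_bxor (hd1.mono (by norm_num)) hd2) true
  have hsetE : (univ.filter fun x : Fin (6 + 6) → Bool =>
      ((decide (Odd (u x / 2)) ^^ decide (Odd (u x / 2 / 2))) ^^ true) = true) = E := by
    rw [hEdef]
    apply filter_congr
    intro x _
    by_cases h1 : Odd (u x / 2) <;> by_cases h2 : Odd (u x / 2 / 2) <;> simp [h1, h2]
  have hsumE : (∑ x, (if (Odd (u x / 2) ↔ Odd (u x / 2 / 2)) then 1 else 0 : ℤ)) = #E := by rw [sum_boole]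
  -- budget and the wild function
  have hbud := tw12_budget f g u hu
  have hT : (∑ x, (u x - 4 * sZ (f x)) ^ 2 : ℤ) ≤ 11776 := by
    have h' : ((∑ x, (u x - 4 * sZ (f x)) ^ 2 : ℤ) : ℝ) ≤ 11776 := by rw [hbud]; linarith
    exact_mod_cast h'
  choose v hv using fun x => to12_pt_mod8 (u x) (sZ (f x)) (hall x) (tp_sZ_cases (f x))
  set τ₀ : (Fin (6 + 6) → Bool) → ℤ := fun x =>
    sZ (decide (Odd (u x / 2))) * (1 - 4 * (if (Odd (u x / 2) ↔ Odd (u x / 2 / 2)) then 1 else 0)) with hτ₀def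
  have hvx : ∀ x, u x - 4 * sZ (f x) = τ₀ x + 8 * v x := fun x => hv x
  have hτ₀val : ∀ x, τ₀ x = 1 ∨ τ₀ x = -1 ∨ τ₀ x = 3 ∨ τ₀ x = -3 := by
    intro x
    simp only [τ₀]
    rcases tp_sZ_cases (decide (Odd (u x / 2))) with h | h <;> rw [h] <;> split_ifs <;> norm_num
  have hτ₀sq : ∀ x, τ₀ x ^ 2 = 1 + 8 * (if (Odd (u x / 2) ↔ Odd (u x / 2 / 2)) then 1 else 0 : ℤ) := by
    intro x
    simp only [τ₀]
    rcases tp_sZ_cases (decide (Odd (u x / 2))) with h | h <;> rw [h] <;> split_ifs <;> norm_num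
  have hsumτ₀ : ∑ x, τ₀ x ^ 2 = 11264 := by
    rw [sum_congr rfl fun x _ => hτ₀sq x, sum_add_distrib, ← mul_sum, hsumE, sum_const, card_univ, Fintype.card_fun,
      Fintype.card_bool, Fintype.card_fin]
    change (4096 : ℕ) • (1 : ℤ) + 8 * ((#E : ℕ) : ℤ) = 11264
    rw [hE]; norm_num
  -- `X ≥ 16 v²` pointwise, hence `Σ v² ≤ 32`
  have hX16 : ∀ x, 16 * v x ^ 2 ≤ (τ₀ x + 8 * v x) ^ 2 - τ₀ x ^ 2 := by
    intro x
    have hv3 : v x = 0 ∨ 1 ≤ v x ∨ v x ≤ -1 := by omega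
    rcases hv3 with h0 | h1 | h1
    · rw [h0]; ring_nf; rfl
    · rcases hτ₀val x with h | h | h | h <;> rw [h] <;> nlinarith
    · rcases hτ₀val x with h | h | h | h <;> rw [h] <;> nlinarith
  have hTdec : (∑ x, (u x - 4 * sZ (f x)) ^ 2 : ℤ) = ∑ x, τ₀ x ^ 2 + ∑ x, ((τ₀ x + 8 * v x) ^ 2 - τ₀ x ^ 2) := by
    rw [← sum_add_distrib]
    exact sum_congr rfl fun x _ => by rw [hvx x]; ring
  have hv2 : ∑ x, v x ^ 2 ≤ 32 := by
    have h1 : 16 * ∑ x, v x ^ 2 ≤ ∑ x, ((τ₀ x + 8 * v x) ^ 2 - τ₀ x ^ 2) := by rw [mul_sum]; exact sum_le_sum fun x _ => hX16 x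
    rw [hTdec, hsumτ₀] at hT
    linarith
  -- `v ≢ 0` (else `Φ = 936/1024`)
  have hvne : ∃ x, v x ≠ 0 := by
    by_contra hnone
    push Not at hnone
    have hT0 : (∑ x, (u x - 4 * sZ (f x)) ^ 2 : ℤ) = 11264 := by
      rw [hTdec, hsumτ₀, sum_eq_zero fun x _ => by rw [hnone x]; ring]; ring
    have hΦ936 : forrelation f g = 936 / 1024 := by
      have : ((11264 : ℤ) : ℝ) = (2 : ℝ) ^ 17 * (1 - forrelation f g) := by rw [← hT0]; exact hbud
      norm_num at this; linarith
    exact to18_typeO_ge936_false f g hf hg u hu hodd (by rw [hΦ936])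
  -- Parseval for `v`
  set Vh : (Fin (6 + 6) → Bool) → ℝ := fun y => ∑ x, (v x : ℝ) * twist x y with hVh
  have hParsV : ∑ y, Vh y ^ 2 = 4096 * ((∑ x, v x ^ 2 : ℤ) : ℝ) := by
    have h := sum_W_sq (n := 6 + 6) (fun x => (v x : ℝ))
    unfold W at h
    rw [h]; push_cast; norm_num
  -- the partner identity with `Ê ∈ 128ℤ`: `Vh(y) = 8·(4 sg − 64 s_b [c₁ ⊕ y = 0] + 8 s_b m − u_f(y))`
  have hsb : signOf b₁ = 1 ∨ signOf b₁ = -1 := by cases b₁ <;> simp [signOf]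
  have hid : ∀ y, ∃ m : ℤ, Vh y = 8 * (4 * signOf (g y) - 64 * signOf b₁ * (if bxor c₁ y = (fun _ => false) then (1 : ℝ) else 0) +
      8 * signOf b₁ * (m : ℝ) - (uf y : ℝ)) := by
    intro y
    have h := to18_typeO_partner_identity f g u hu v hv c₁ b₁ hcb uf huf y
    rw [← hEdef] at h
    obtain ⟨m, hm⟩ := to18_char_sum_E896 _ hdegE (by rw [hsetE]; exact hE) (bxor c₁ y)
    rw [hsetE] at hm
    rw [hm] at h
    refine ⟨m, ?_⟩
    simp only [Vh]
    split_ifs at h with hz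
    · rw [if_pos hz]; norm_num at h ⊢; linarith
    · rw [if_neg hz]; linarith
  -- `Vh y = 8 K` with `K + u_f(y)` even
  have hK8 : ∀ y, ∃ K : ℤ, Vh y = 8 * (K : ℝ) ∧ Even (K + uf y) := by
    intro y
    obtain ⟨m, hm⟩ := hid y
    by_cases hz : bxor c₁ y = (fun _ => false)
    · rw [if_pos hz] at hm
      refine ⟨4 * sZ (g y) - 64 * sZ b₁ + 8 * sZ b₁ * m - uf y, ?_, ⟨2 * sZ (g y) - 32 * sZ b₁ + 4 * sZ b₁ * m, by ring⟩⟩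
      rw [hm]; push_cast; rw [tp_sZ_cast, tp_sZ_cast]; ring
    · rw [if_neg hz] at hm
      refine ⟨4 * sZ (g y) + 8 * sZ b₁ * m - uf y, ?_, ⟨2 * sZ (g y) + 4 * sZ b₁ * m, by ring⟩⟩
      rw [hm]; push_cast; rw [tp_sZ_cast, tp_sZ_cast]; ring
  /- (a) `f` is not type O: otherwise `|Vh| ≥ 8` everywhere and `Σ v² ≥ 64` -/
  have hnotO : ¬ ∃ y, Odd (uf y) := by
    rintro ⟨y₀, hy₀⟩
    have hallf : ∀ y, Odd (uf y) := TypeOTwelve.typeO_of_exists_odd f uf hf huf ⟨y₀, hy₀⟩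
    have h8 : ∀ y, 64 ≤ Vh y ^ 2 := by
      intro y
      obtain ⟨K, hK, hKuf⟩ := hK8 y
      have hKodd : Odd K := by
        by_contra hKe
        have h := (Int.even_add.1 hKuf).1 (Int.not_odd_iff_even.1 hKe)
        exact (Int.not_even_iff_odd.2 (hallf y)) h
      have hK1 : (1 : ℝ) ≤ (K : ℝ) ^ 2 := by
        obtain ⟨j, hj⟩ := hKodd
        have : K ≤ -1 ∨ 1 ≤ K := by omega
        have h2 : 1 ≤ K ^ 2 := by rcases this with h | h <;> nlinarith
        exact_mod_cast h2
      rw [hK]; nlinarith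
    have hsum : (4096 : ℝ) * 64 ≤ ∑ y, Vh y ^ 2 := by
      have := sum_le_sum fun y (_ : y ∈ (univ : Finset (Fin (6 + 6) → Bool))) => h8 y
      rw [sum_const, card_univ, Fintype.card_fun, Fintype.card_bool, Fintype.card_fin] at this
      norm_num at this ⊢; linarith
    rw [hParsV] at hsum
    have : (64 : ℝ) ≤ ((∑ x, v x ^ 2 : ℤ) : ℝ) := by linarith
    have : (64 : ℤ) ≤ ∑ x, v x ^ 2 := by exact_mod_cast this
    linarith
  refine ⟨fun y hy => hnotO ⟨y, hy⟩, ?_⟩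
  · /- (b) `f` is not at level `≥ 6` -/
    intro h6
    have hoddf : ∀ y, ¬ Odd (uf y) := fun y hy => hnotO ⟨y, hy⟩
    -- `4 ∣ uf`
    have h4 : ∀ y, ∃ k, uf y = 4 * k := by
      intro y
      obtain ⟨a, ha⟩ := Int.not_odd_iff_even.1 (hoddf y)
      obtain ⟨b, hb⟩ := Int.not_odd_iff_even.1 (h6 y)
      refine ⟨b, ?_⟩
      have : uf y / 2 = a := by rw [ha]; omega
      rw [this] at hb
      omega
    choose k hk using h4
    -- the level-6 form of `f`
    have hwf : ∀ y, W (fun x => signOf (f x)) y = (2 : ℝ) ^ 6 * (k y : ℝ) := by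
      intro y; rw [huf y, hk y]; push_cast; ring
    -- `Vh y = 32·(sg − 16 s_b δ + 2 s_b m − k y)` : in `32ℤ`, and `|Vh y| ≤ 32`
    have hV32 : ∀ y, ∃ K : ℤ, Vh y = 32 * (K : ℝ) ∧ (Odd (k y) ↔ Even K) := by
      intro y
      obtain ⟨m, hm⟩ := hid y
      have hky : (uf y : ℝ) = 4 * (k y : ℝ) := by exact_mod_cast hk y
      rw [hky] at hm
      have hpar : ∀ K : ℤ, Odd (K + k y) → (Odd (k y) ↔ Even K) := by
        intro K hK
        constructor
        · intro hko
          by_contra hKe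
          have := Int.odd_add.1 hK
          exact (Int.not_even_iff_odd.2 hko) (this.1 (Int.not_even_iff_odd.1 hKe))
        · intro hKe
          have := Int.odd_add.1 hK
          by_contra hko
          have hke : Even (k y) := Int.not_odd_iff_even.1 hko
          have : Odd K := this.2 hke
          exact (Int.not_even_iff_odd.2 this) hKe
      have hsg1 : Odd (sZ (g y)) := by rcases tp_sZ_cases (g y) with h | h <;> rw [h] <;> decide
      by_cases hz : bxor c₁ y = (fun _ => false)
      · rw [if_pos hz] at hm
        refine ⟨sZ (g y) - 16 * sZ b₁ + 2 * sZ b₁ * m - k y, ?_, hpar _ ?_⟩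
        · rw [hm]; push_cast; rw [tp_sZ_cast, tp_sZ_cast]; ring
        · have e : sZ (g y) - 16 * sZ b₁ + 2 * sZ b₁ * m - k y + k y = sZ (g y) + 2 * (-8 * sZ b₁ + sZ b₁ * m) := by ring
          rw [e]; exact hsg1.add_even ⟨-8 * sZ b₁ + sZ b₁ * m, by ring⟩
      · rw [if_neg hz] at hm
        refine ⟨sZ (g y) + 2 * sZ b₁ * m - k y, ?_, hpar _ ?_⟩
        · rw [hm]; push_cast; rw [tp_sZ_cast, tp_sZ_cast]; ring
        · have e : sZ (g y) + 2 * sZ b₁ * m - k y + k y = sZ (g y) + 2 * (sZ b₁ * m) := by ring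
          rw [e]; exact hsg1.add_even ⟨sZ b₁ * m, by ring⟩
    have hVle : ∀ y, |Vh y| ≤ 32 := by
      intro y
      have h1 : |Vh y| ≤ ∑ x, |(v x : ℝ)| := by
        calc |Vh y| ≤ ∑ x, |(v x : ℝ) * twist x y| := abs_sum_le_sum_abs _ _
          _ = ∑ x, |(v x : ℝ)| := sum_congr rfl fun x _ => by
              rw [abs_mul]; rcases twist_eq_one_or x y with h | h <;> rw [h] <;> simp
      have h2 : ∑ x, |(v x : ℝ)| ≤ ∑ x, ((v x : ℝ)) ^ 2 := sum_le_sum fun x _ => by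
        rw [← sq_abs]
        rcases eq_or_ne (v x) 0 with h | h
        · rw [h]; simp
        · have : (1 : ℝ) ≤ |(v x : ℝ)| := by
            rw [← Int.cast_abs]; exact_mod_cast Int.one_le_abs h
          nlinarith
      have h3 : ∑ x, ((v x : ℝ)) ^ 2 ≤ 32 := by
        have : ((∑ x, v x ^ 2 : ℤ) : ℝ) ≤ 32 := by exact_mod_cast hv2
        push_cast at this; exact this
      linarith
    -- the parity set `Z_f = {k even} = {Vh ≠ 0}` has `≤ 128` points but is a nonempty cubic support
    set Zf := univ.filter (fun y : Fin (6 + 6) → Bool => ¬ Odd (k y)) with hZf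
    have hZfV : ∀ y, y ∈ Zf ↔ Vh y ≠ 0 := by
      intro y
      obtain ⟨K, hK, hpar⟩ := hV32 y
      rw [hZf, mem_filter]
      simp only [mem_univ, true_and]
      rw [hK]
      constructor
      · intro hne hzero
        have hK0 : (K : ℝ) = 0 := by linarith
        have : K = 0 := by exact_mod_cast hK0
        exact hne (hpar.2 ⟨0, by omega⟩)
      · intro hne hko
        obtain ⟨j, hj⟩ := hpar.1 hko
        -- `K = 2j`, `|32 K| ≤ 32` ⇒ `K = 0`
        have hb := hVle y
        rw [hK, hj] at hb
        have h1 : |(32 : ℝ) * ((j + j : ℤ) : ℝ)| ≤ 32 := hb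
        rw [abs_mul, abs_of_pos (by norm_num : (0 : ℝ) < 32)] at h1
        push_cast at h1
        have hj0 : j = 0 := by
          by_contra hj0
          have h2 : (1 : ℝ) ≤ |(j : ℝ)| := by rw [← Int.cast_abs]; exact_mod_cast Int.one_le_abs hj0
          have h3 : |(j : ℝ) + (j : ℝ)| = 2 * |(j : ℝ)| := by
            rw [← two_mul, abs_mul, abs_of_pos (by norm_num : (0 : ℝ) < 2)]
          rw [h3] at h1
          linarith
        apply hne
        rw [hj, hj0]; norm_num
    -- `#Zf ≤ 128`: every `y ∈ Zf` has `Vh y ^ 2 = 1024`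
    have hZfsq : ∀ y ∈ Zf, (1024 : ℝ) ≤ Vh y ^ 2 := by
      intro y hy
      obtain ⟨K, hK, -⟩ := hV32 y
      have hne := (hZfV y).1 hy
      rw [hK] at hne ⊢
      have hK0 : K ≠ 0 := by rintro rfl; exact hne (by simp)
      have : (1 : ℝ) ≤ (K : ℝ) ^ 2 := by
        have h1 : 1 ≤ K ^ 2 := by
          have : K ≤ -1 ∨ 1 ≤ K := by omega
          rcases this with h | h <;> nlinarith
        exact_mod_cast h1
      nlinarith
    have hZf128 : (#Zf : ℝ) ≤ 128 := by
      have h1 : ∑ y ∈ Zf, (1024 : ℝ) ≤ ∑ y ∈ Zf, Vh y ^ 2 := sum_le_sum hZfsq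
      have h2 : ∑ y ∈ Zf, Vh y ^ 2 ≤ ∑ y, Vh y ^ 2 :=
        sum_le_sum_of_subset_of_nonneg (subset_univ _) fun y _ _ => sq_nonneg _
      rw [sum_const, nsmul_eq_mul] at h1
      rw [hParsV] at h2
      have h3 : ((∑ x, v x ^ 2 : ℤ) : ℝ) ≤ 32 := by exact_mod_cast hv2
      nlinarith
    -- `Zf` nonempty: `v ≢ 0` ⇒ `Σ Vh² > 0` ⇒ some `Vh y ≠ 0`
    have hZfne : ∃ y, y ∈ Zf := by
      by_contra hnone
      push Not at hnone
      have hall0 : ∀ y, Vh y = 0 := fun y => by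
        by_contra h; exact hnone y ((hZfV y).2 h)
      have h0 : ∑ y, Vh y ^ 2 = 0 := sum_eq_zero fun y _ => by rw [hall0 y]; ring
      rw [hParsV] at h0
      obtain ⟨x₀, hx₀⟩ := hvne
      have h1 : (1 : ℤ) ≤ ∑ x, v x ^ 2 := by
        have : v x₀ ^ 2 ≤ ∑ x, v x ^ 2 := single_le_sum (f := fun x => v x ^ 2) (fun x _ => sq_nonneg _) (mem_univ x₀)
        have : 1 ≤ v x₀ ^ 2 := by
          have : v x₀ ≤ -1 ∨ 1 ≤ v x₀ := by omega
          rcases this with h | h <;> nlinarith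
        linarith
      have : (1 : ℝ) ≤ ((∑ x, v x ^ 2 : ℤ) : ℝ) := by exact_mod_cast h1
      linarith
    -- cubic parity and the Reed–Muller bound
    have hp : IsDegLeFun 3 (fun y => decide (Odd (k y))) :=
      stub_walshTower stub_axParity (6 + 6) 6 3 f k hf hwf (by intro k hk hkn; omega)
    have hp' : IsDegLeFun (2 + 1) (fun y => decide (Odd (k y)) ^^ true) := tb_isDegLeFun_xor_const hp true
    have hfilt : (univ.filter fun y : Fin (6 + 6) → Bool => (decide (Odd (k y)) ^^ true) = true) = Zf :=
      filter_congr fun y _ => by simp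
    obtain ⟨y₁, hy₁⟩ := hZfne
    have hRM := bb_rmWeight_holds (6 + 6) 3 (fun y => decide (Odd (k y)) ^^ true) hp' ⟨y₁, by
      have := (mem_filter.1 hy₁).2; simpa using this⟩
    rw [hfilt] at hRM
    have : (512 : ℝ) ≤ #Zf := by
      have h : 512 ≤ #Zf := by norm_num at hRM; omega
      exact_mod_cast h
    linarith

end Summit.QuantumAdvantage.QuantumAdvantage.Theorems.CubicForrelation.NearExactIsExact

end
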